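import Summits.ValiantsHypothesis.ValiantsHypothesis.Theses.DivisionGap
import Literature.Barriers.ValiantsHypothesis.MonotoneGapMatrixTree
import Literature.Computability.AlgebraicComplexity.IMMInVPProofs
import Literature.Computability.AlgebraicComplexity.ArithCircuitProofs
import HarnessLib

/-!
# Route DivisionGap — support item `StDivisionEasy` (stmt-ValiantsHypothesis-10463)

**Claim settled.** `Summit.ValiantsHypothesis.ValiantsHypothesis.Theses.DivisionGap.StDivisionEasy`:
there is `c` (here `c = 64`) such that for every `N` some nonzero `h ∈ ℝ≥0[x_{(i,v)}]` has
`L₊(ST_N · h) + L₊(h) ≤ N ^ c + c`, where `ST_N = Σ_{t arborescence} Π_i x_{i, t i}` is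
Jerrum–Snir's directed spanning tree polynomial (the route states it inline; it is literally
`Literature.Barriers.ValiantsHypothesis.stPoly ℝ≥0 N`, `inline_eq_stPoly`) and `L₊` is the tree's
fan-in-two circuit size `complexity` over the semiring `ℝ≥0` (monotone circuits). This is the
division-free normal form of Fomin–Grigoriev–Koshevoy's theorem that `ST` has polynomial-size
subtraction-free circuits WITH division (arXiv:1307.8425, Thm 7.2 via the star–mesh Lemma 7.3).

## Proof

* `chio_condensation` — Chio's pivotal condensation in the uncancelled form
  `d ^ n · det M = d · det (d · M_{i⁺j⁺} - M_{i⁺0} · M_{0j⁺})`, `d = M₀₀`, over any commutative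
  ring (row scaling `Matrix.det_mul_column`, row operations
  `Matrix.det_eq_of_forall_row_eq_smul_add_const`, Laplace expansion `Matrix.det_succ_column_zero`).
* `stPoly_succ_mul_pow_ring` — applied to the reduced Laplacian of the tree's matrix-tree theorem
  (`det_stLaplacian`, `MonotoneGapMatrixTree.lean`) with pivot the out-weight
  `s = Σ_{v ≠ 0} x_{0v}` of the node `0`, the condensed matrix IS the reduced Laplacian of the
  star–mesh weights `e (i, w) = x_{i⁺ w⁺} · s + x_{i⁺ 0} · x_{0 w⁺}` (no subtraction, no division),
  whence `ST_{n+1} · s ^ n = s · ST_n(e)`.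
* `stPoly_succ_mul_pow` — the same identity over the semiring `ℝ≥0` (`ℝ≥0[x] ↪ ℝ[x]`).
* `exists_stPoly_mul` — iterate: `F_{n+1} = s · F_n(e)`, `h_{n+1} = s ^ n · h_n(e)`, `F_0 = h_0 = 1`
  gives `F_N = ST_N · h_N` with `h_N > 0` at positive points; by the substitution bound
  `L(f(g)) ≤ L(f) + Σ L(g_v)` (`complexity_aeval_le`) and `L(s) ≤ n + 1`, `L(e_v) ≤ n + 4`,
  both `L(F_N)` and `L(h_N)` are `≤ 2 (N+1)^4`.
* `stDivisionEasy_proof` — `4 (N+1)^4 ≤ N^64 + 64`.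

Imports the MonotoneGap barrier files only for the definitions `stPoly`/`stLaplacian` and the
matrix-tree theorem (allowed for a Theorems file by the item's text); no named fact is assumed —
the result is unconditional (axioms `propext`, `Classical.choice`, `Quot.sound`).

## References

* [FominGrigorievKoshevoy2014] S. Fomin, D. Grigoriev, G. Koshevoy, *Subtraction-free complexity,
  cluster transformations, and spanning trees*, Found. Comput. Math. (2016), arXiv:1307.8425,
  §7 (Lemma 7.3 star–mesh, Thm 7.2).
* [JerrumSnir1982] M. Jerrum, M. Snir, J. ACM 29 (1982), §4.5 (`ST`), §5.1.
* [Burgisser2000] P. Bürgisser, *Completeness and Reduction in Algebraic Complexity Theory*,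
  Def. 2.1, Rem. 2.7.
-/

noncomputable section

namespace Summit.ValiantsHypothesis.DivisionGap

open MvPolynomial Finset Literature.Computability.AlgebraicComplexity
  Literature.Barriers.ValiantsHypothesis

open scoped NNReal

/-- **Chio's pivotal condensation, uncancelled form.** For a square matrix `M` of size `n + 1`
over a commutative ring with pivot `d = M 0 0`:
`d ^ n · det M = d · det (d · M_{i'j'} - M_{i'0} · M_{0j'})_{i,j < n}` (`i' = i + 1`): scale the
rows `1, …, n` by `d`, clear the first column with the first row, expand along the first column.
[folklore] -/
theorem chio_condensation {R : Type*} [CommRing R] {n : ℕ}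
    (M : Matrix (Fin (n + 1)) (Fin (n + 1)) R) :
    M 0 0 ^ n * M.det =
      M 0 0 * (Matrix.of fun i j : Fin n =>
        M 0 0 * M i.succ j.succ - M i.succ 0 * M 0 j.succ).det := by
  -- step 1: scale the rows `1, …, n` by the pivot
  set v : Fin (n + 1) → R := Fin.cons 1 (fun _ => M 0 0) with hv
  set M₁ : Matrix (Fin (n + 1)) (Fin (n + 1)) R := Matrix.of fun i j => v i * M i j with hM₁
  have h1 : M₁.det = M 0 0 ^ n * M.det := by
    rw [hM₁, Matrix.det_mul_column, Fin.prod_univ_succ]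
    simp [hv]
  -- step 2: subtract `M i 0` times row `0` from row `i ≠ 0`
  set c : Fin (n + 1) → R := Fin.cons 0 (fun i => -M i.succ 0) with hc
  set M₂ : Matrix (Fin (n + 1)) (Fin (n + 1)) R :=
    Matrix.of fun i j => M₁ i j + c i * M₁ 0 j with hM₂
  have h2 : M₂.det = M₁.det :=
    Matrix.det_eq_of_forall_row_eq_smul_add_const c 0 (by simp [hc]) (fun i j => by simp [hM₂])
  -- step 3: the first column of `M₂` is `(d, 0, …, 0)`; expand along it
  have hcol : ∀ i : Fin n, M₂ i.succ 0 = 0 := by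
    intro i
    simp only [hM₂, hM₁, hv, hc, Matrix.of_apply, Fin.cons_succ, Fin.cons_zero, one_mul]
    ring
  have h00 : M₂ 0 0 = M 0 0 := by simp [hM₂, hM₁, hv, hc]
  have hsub : M₂.submatrix Fin.succ Fin.succ =
      Matrix.of fun i j : Fin n => M 0 0 * M i.succ j.succ - M i.succ 0 * M 0 j.succ := by
    ext i j
    simp only [hM₂, hM₁, hv, hc, Matrix.submatrix_apply, Matrix.of_apply, Fin.cons_succ,
      Fin.cons_zero, one_mul]
    ring
  have h3 : M₂.det = M 0 0 * (Matrix.of fun i j : Fin n =>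
      M 0 0 * M i.succ j.succ - M i.succ 0 * M 0 j.succ).det := by
    rw [Matrix.det_succ_column_zero, Fin.sum_univ_succ]
    simp only [Fin.val_zero, pow_zero, one_mul, Fin.succAbove_zero, hsub, h00]
    rw [Finset.sum_eq_zero (fun i _ => by rw [hcol]; ring), add_zero]
  rw [← h1, ← h2, h3]

/-- **Star–mesh elimination of the node `0`, ring form.** With `s = L₀₀ = Σ_{v ≠ 0} x_{0v}` the
out-weight of the node `0` and the subtraction-free substitution
`e (i, w) = x_{i⁺ w⁺} · s + x_{i⁺ 0} · x_{0 w⁺}` (`⁺ = Fin.succ`, root fixed):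
`ST_{n+1} · s ^ n = s · ST_n(e)`. Proof: Chio condensation of the reduced Laplacian
(`det_stLaplacian`), whose condensed matrix is the reduced Laplacian of the weights `e`.
[cite: FominGrigorievKoshevoy2014, Lemma 7.3] -/
theorem stPoly_succ_mul_pow_ring (R : Type*) [CommRing R] (n : ℕ) :
    stPoly R (n + 1) * (stLaplacian R (n + 1) 0 0) ^ n =
      stLaplacian R (n + 1) 0 0 *
        bind₁ (fun τ : Fin n × Option (Fin n) =>
          X (τ.1.succ, τ.2.map Fin.succ) * stLaplacian R (n + 1) 0 0 +
            X (τ.1.succ, some 0) * X (0, τ.2.map Fin.succ)) (stPoly R n) := by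
  set s := stLaplacian R (n + 1) 0 0 with hs_def
  set e : Fin n × Option (Fin n) → MvPolynomial (Fin (n + 1) × Option (Fin (n + 1))) R :=
    fun τ => X (τ.1.succ, τ.2.map Fin.succ) * s + X (τ.1.succ, some 0) * X (0, τ.2.map Fin.succ)
    with he_def
  have hchio := chio_condensation (stLaplacian R (n + 1))
  rw [det_stLaplacian] at hchio
  -- the condensed matrix is the reduced Laplacian of the new weights
  have hmat : (Matrix.of fun i j : Fin n =>
      s * stLaplacian R (n + 1) i.succ j.succ -
        stLaplacian R (n + 1) i.succ 0 * stLaplacian R (n + 1) 0 j.succ) =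
      (bind₁ e).toRingHom.mapMatrix (stLaplacian R n) := by
    ext i j
    rw [Matrix.of_apply, RingHom.mapMatrix_apply, Matrix.map_apply,
      stLaplacian_apply_of_ne (Fin.succ_ne_zero i),
      stLaplacian_apply_of_ne (Fin.succ_ne_zero j).symm]
    by_cases hij : i = j
    · subst hij
      rw [stLaplacian_apply_self, stLaplacian_apply_self]
      simp only [AlgHom.toRingHom_eq_coe, RingHom.coe_coe, map_sum, bind₁_X_right, he_def]
      -- expand all the `erase`-sums
      have hs : s = X (0, none) + ∑ k : Fin n, X (0, some k.succ) := by
        rw [hs_def, stLaplacian_apply_self, Finset.sum_erase_eq_sub (Finset.mem_univ _),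
          Fintype.sum_option, Fin.sum_univ_succ]
        ring
      rw [Finset.sum_erase_eq_sub (Finset.mem_univ _), Finset.sum_erase_eq_sub (Finset.mem_univ _),
        Fintype.sum_option, Fintype.sum_option, Fin.sum_univ_succ, Finset.sum_add_distrib,
        ← Finset.sum_mul, ← Finset.mul_sum]
      simp only [Option.map_none, Option.map_some]
      rw [hs]
      ring
    · have hij' : i.succ ≠ j.succ := fun h => hij (Fin.succ_injective _ h)
      rw [stLaplacian_apply_of_ne hij', stLaplacian_apply_of_ne hij]
      simp only [AlgHom.toRingHom_eq_coe, RingHom.coe_coe, map_neg, bind₁_X_right, he_def,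
        Option.map_some]
      ring
  rw [hmat, ← RingHom.map_det, det_stLaplacian] at hchio
  rw [mul_comm]
  exact hchio

/-! ### Transfer to the semiring `ℝ≥0` and the cost of one elimination step -/

/-- **Star–mesh elimination over `ℝ≥0`.** The identity `ST_{n+1} · s ^ n = s · ST_n(e)` of
`stPoly_succ_mul_pow_ring` holds verbatim over the semiring `ℝ≥0` (both sides have coefficients
in `ℝ≥0 ⊆ ℝ` and `ℝ≥0[x] → ℝ[x]` is injective): `s = Σ_{v ≠ 0} x_{0v}`,
`e (i, w) = x_{i⁺ w⁺} · s + x_{i⁺ 0} · x_{0 w⁺}` are subtraction-free.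
[cite: FominGrigorievKoshevoy2014, Lemma 7.3] -/
theorem stPoly_succ_mul_pow (n : ℕ) :
    stPoly ℝ≥0 (n + 1) *
        (∑ v ∈ univ.erase (some 0), X (0, v) :
          MvPolynomial (Fin (n + 1) × Option (Fin (n + 1))) ℝ≥0) ^ n =
      (∑ v ∈ univ.erase (some 0), X (0, v) :
          MvPolynomial (Fin (n + 1) × Option (Fin (n + 1))) ℝ≥0) *
        bind₁ (fun τ : Fin n × Option (Fin n) =>
          X (τ.1.succ, τ.2.map Fin.succ) *
              (∑ v ∈ univ.erase (some 0), X (0, v) :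
                MvPolynomial (Fin (n + 1) × Option (Fin (n + 1))) ℝ≥0) +
            X (τ.1.succ, some 0) * X (0, τ.2.map Fin.succ)) (stPoly ℝ≥0 n) := by
  apply MvPolynomial.map_injective NNReal.toRealHom NNReal.coe_injective
  have hs : map NNReal.toRealHom (∑ v ∈ univ.erase (some 0), X (0, v) :
      MvPolynomial (Fin (n + 1) × Option (Fin (n + 1))) ℝ≥0) = stLaplacian ℝ (n + 1) 0 0 := by
    rw [stLaplacian_apply_self, map_sum]
    simp only [map_X]
  simp only [map_mul, map_pow, map_bind₁, map_add, map_X, hs, map_stPoly]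
  exact stPoly_succ_mul_pow_ring ℝ n

/-- The pivot `s = Σ_{v ≠ 0} x_{0v}` (a sum of `n + 1` variables) costs at most `n + 1` gates.
[cite: Burgisser2000, §2.1] -/
theorem complexity_pivot_le (n : ℕ) :
    complexity (∑ v ∈ univ.erase (some 0), X (0, v) :
      MvPolynomial (Fin (n + 1) × Option (Fin (n + 1))) ℝ≥0) ≤ n + 1 := by
  refine (complexity_finset_sum_le _ _).trans ?_
  rw [Finset.sum_eq_zero (fun v _ => complexity_X_holds _), zero_add,
    Finset.card_erase_of_mem (Finset.mem_univ _), Finset.card_univ, Fintype.card_option,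
    Fintype.card_fin, Nat.add_sub_cancel]

/-- Each new weight `e (i, w) = x_{i⁺ w⁺} · s + x_{i⁺ 0} · x_{0 w⁺}` costs at most `n + 4` gates
(no sharing of `s` is claimed). [cite: Burgisser2000, §2.1] -/
theorem complexity_subst_le (n : ℕ) (τ : Fin n × Option (Fin n)) :
    complexity (X (τ.1.succ, τ.2.map Fin.succ) *
          (∑ v ∈ univ.erase (some 0), X (0, v) :
            MvPolynomial (Fin (n + 1) × Option (Fin (n + 1))) ℝ≥0) +
        X (τ.1.succ, some 0) * X (0, τ.2.map Fin.succ)) ≤ n + 4 := by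
  set s := (∑ v ∈ univ.erase (some 0), X (0, v) :
    MvPolynomial (Fin (n + 1) × Option (Fin (n + 1))) ℝ≥0) with hs
  calc complexity (X (τ.1.succ, τ.2.map Fin.succ) * s +
          X (τ.1.succ, some 0) * X (0, τ.2.map Fin.succ))
      ≤ complexity (X (τ.1.succ, τ.2.map Fin.succ) * s) +
          complexity (X (τ.1.succ, some 0) * X (0, τ.2.map Fin.succ) :
            MvPolynomial (Fin (n + 1) × Option (Fin (n + 1))) ℝ≥0) + 1 :=
        complexity_add_le_holds _ _
    _ ≤ (complexity (X (τ.1.succ, τ.2.map Fin.succ) :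
            MvPolynomial (Fin (n + 1) × Option (Fin (n + 1))) ℝ≥0) + complexity s + 1) +
          (complexity (X (τ.1.succ, some 0) :
              MvPolynomial (Fin (n + 1) × Option (Fin (n + 1))) ℝ≥0) +
            complexity (X (0, τ.2.map Fin.succ) :
              MvPolynomial (Fin (n + 1) × Option (Fin (n + 1))) ℝ≥0) + 1) + 1 := by
        gcongr
        · exact complexity_mul_le_holds _ _
        · exact complexity_mul_le_holds _ _
    _ ≤ (0 + (n + 1) + 1) + (0 + 0 + 1) + 1 := by
        rw [complexity_X_holds, complexity_X_holds, complexity_X_holds]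
        gcongr
        exact complexity_pivot_le n
    _ = n + 4 := by ring

/-- The pivot is positive at every point with positive coordinates. [folklore] -/
theorem eval_pivot_pos (n : ℕ) {x : Fin (n + 1) × Option (Fin (n + 1)) → ℝ≥0}
    (hx : ∀ v, 0 < x v) :
    0 < eval x (∑ v ∈ univ.erase (some 0), X (0, v) :
      MvPolynomial (Fin (n + 1) × Option (Fin (n + 1))) ℝ≥0) := by
  rw [map_sum]
  simp only [eval_X]
  exact Finset.sum_pos (fun v _ => hx _) ⟨none, by simp⟩

/-- `L(f ^ m) ≤ m · L(f) + m` (multiply out one factor at a time). [cite: Burgisser2000, §2.1] -/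
theorem complexity_pow_le {σ : Type*} (f : MvPolynomial σ ℝ≥0) (m : ℕ) :
    complexity (f ^ m) ≤ m * complexity f + m := by
  have h : f ^ m = ∏ _i ∈ Finset.range m, f := by
    rw [Finset.prod_const, Finset.card_range]
  rw [h]
  refine (complexity_finset_prod_le _ _).trans ?_
  rw [Finset.sum_const, Finset.card_range, smul_eq_mul]

/-- `ST_0 = 1`: the empty parent map is the unique arborescence on the root alone. [folklore] -/
theorem stPoly_zero (R : Type*) [CommSemiring R] : stPoly R 0 = 1 := by
  classical
  unfold stPoly
  have hfilter : (univ : Finset (Fin 0 → Option (Fin 0))).filter IsArborescence = univ := by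
    refine Finset.filter_true_of_mem fun t _ => ?_
    intro i
    exact i.elim0
  rw [hfilter]
  simp

/-! ### Iterating the elimination: `ST_N · h_N` and `h_N` are cheap -/

/-- **The iterated star–mesh elimination.** For every `N` there are subtraction-free polynomials
`F = ST_N · h` and `h` over `ℝ≥0`, both of circuit complexity `≤ 2 (N+1)^4`, with `h` positive at
every positive point (so `h ≠ 0`): `F_{n+1} = s · F_n(e)`, `h_{n+1} = s ^ n · h_n(e)`, i.e. `h`
is the product of the (substituted) pivots — Fomin–Grigoriev–Koshevoy's `O(n³)` subtraction-free
computation of `ST` WITH division, in the division-free normal form `ST · h = F`.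
[cite: FominGrigorievKoshevoy2014, Thm 7.2] -/
theorem exists_stPoly_mul (N : ℕ) :
    ∃ F h : MvPolynomial (Fin N × Option (Fin N)) ℝ≥0,
      F = stPoly ℝ≥0 N * h ∧
      (∀ x : Fin N × Option (Fin N) → ℝ≥0, (∀ v, 0 < x v) → 0 < eval x h) ∧
      complexity F ≤ 2 * (N + 1) ^ 4 ∧ complexity h ≤ 2 * (N + 1) ^ 4 := by
  induction N with
  | zero =>
    refine ⟨1, 1, by rw [stPoly_zero, mul_one], fun x _ => by simp, ?_, ?_⟩ <;>
    · rw [← C_1, complexity_C_holds]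
      exact Nat.zero_le _
  | succ n ih =>
    obtain ⟨F, h, hF, hpos, hcF, hch⟩ := ih
    set s : MvPolynomial (Fin (n + 1) × Option (Fin (n + 1))) ℝ≥0 :=
      ∑ v ∈ univ.erase (some 0), X (0, v) with hs
    set e : Fin n × Option (Fin n) → MvPolynomial (Fin (n + 1) × Option (Fin (n + 1))) ℝ≥0 :=
      fun τ => X (τ.1.succ, τ.2.map Fin.succ) * s + X (τ.1.succ, some 0) * X (0, τ.2.map Fin.succ)
      with he
    have hkey : stPoly ℝ≥0 (n + 1) * s ^ n = s * bind₁ e (stPoly ℝ≥0 n) :=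
      stPoly_succ_mul_pow n
    have hs_pos : ∀ x : Fin (n + 1) × Option (Fin (n + 1)) → ℝ≥0, (∀ v, 0 < x v) →
        0 < eval x s := fun x hx => eval_pivot_pos n hx
    have he_pos : ∀ x : Fin (n + 1) × Option (Fin (n + 1)) → ℝ≥0, (∀ v, 0 < x v) →
        ∀ τ, 0 < eval x (e τ) := by
      intro x hx τ
      simp only [he, map_add, map_mul, eval_X]
      exact add_pos_of_pos_of_nonneg (mul_pos (hx _) (hs_pos x hx)) (_root_.zero_le)
    have hs_c : complexity s ≤ n + 1 := complexity_pivot_le n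
    have hsum_c : ∑ τ : Fin n × Option (Fin n), complexity (e τ) ≤ n * (n + 1) * (n + 4) := by
      calc ∑ τ : Fin n × Option (Fin n), complexity (e τ)
          ≤ ∑ _τ : Fin n × Option (Fin n), (n + 4) :=
            Finset.sum_le_sum fun τ _ => complexity_subst_le n τ
        _ = n * (n + 1) * (n + 4) := by
            rw [Finset.sum_const, Finset.card_univ, Fintype.card_prod, Fintype.card_option,
              Fintype.card_fin, smul_eq_mul]
    refine ⟨s * bind₁ e F, s ^ n * bind₁ e h, ?_, ?_, ?_, ?_⟩
    · rw [hF, map_mul, ← mul_assoc, ← hkey]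
      ring
    · intro x hx
      rw [map_mul, map_pow]
      refine mul_pos (pow_pos (hs_pos x hx) n) ?_
      rw [show eval x (bind₁ e h) = eval (fun τ => eval x (e τ)) h from eval₂Hom_bind₁ _ _ _ _]
      exact hpos _ (he_pos x hx)
    · calc complexity (s * bind₁ e F)
          ≤ complexity s + complexity (bind₁ e F) + 1 := complexity_mul_le_holds _ _
        _ ≤ (n + 1) + (complexity F + ∑ τ, complexity (e τ)) + 1 := by
            gcongr
            exact complexity_aeval_le _ _
        _ ≤ (n + 1) + (2 * (n + 1) ^ 4 + n * (n + 1) * (n + 4)) + 1 := by gcongr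
        _ ≤ 2 * (n + 1 + 1) ^ 4 := by
            have : 0 ≤ n := Nat.zero_le n
            nlinarith [sq_nonneg (n : ℕ), sq_nonneg ((n : ℕ) + 1)]
    · calc complexity (s ^ n * bind₁ e h)
          ≤ complexity (s ^ n) + complexity (bind₁ e h) + 1 := complexity_mul_le_holds _ _
        _ ≤ (n * complexity s + n) + (complexity h + ∑ τ, complexity (e τ)) + 1 := by
            gcongr
            · exact complexity_pow_le s n
            · exact complexity_aeval_le _ _
        _ ≤ (n * (n + 1) + n) + (2 * (n + 1) ^ 4 + n * (n + 1) * (n + 4)) + 1 := by gcongr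
        _ ≤ 2 * (n + 1 + 1) ^ 4 := by
            nlinarith [sq_nonneg (n : ℕ), sq_nonneg ((n : ℕ) + 1)]

/-! ### The item -/

/-- The route's inline spanning-tree polynomial is the tree's `stPoly ℝ≥0 N` (same sum, up to the
`Decidable` instance of the filter). [folklore] -/
theorem inline_eq_stPoly (N : ℕ)
    [DecidablePred fun t : Fin N → Option (Fin N) =>
      ∀ i : Fin N, ∃ r : ℕ, (fun v : Option (Fin N) => v.bind t)^[r] (some i) = none] :
    (∑ t ∈ (Finset.univ : Finset (Fin N → Option (Fin N))).filter
        (fun t => ∀ i : Fin N, ∃ r : ℕ, (fun v : Option (Fin N) => v.bind t)^[r] (some i) = none),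
      ∏ i : Fin N, (MvPolynomial.X (i, t i) : MvPolynomial (Fin N × Option (Fin N)) ℝ≥0)) =
      stPoly ℝ≥0 N := by
  unfold stPoly IsArborescence parentMap
  convert rfl

/-- Polynomial growth bookkeeping: `4 (N+1)^4 ≤ N^64 + 64`. [folklore] -/
theorem four_mul_succ_pow_four_le (N : ℕ) : 4 * (N + 1) ^ 4 ≤ N ^ 64 + 64 := by
  rcases Nat.lt_or_ge N 2 with hN | hN
  · interval_cases N <;> norm_num
  · have h1 : N + 1 ≤ N ^ 2 := by nlinarith
    have h2 : (N + 1) ^ 4 ≤ (N ^ 2) ^ 4 := Nat.pow_le_pow_left h1 4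
    have h3 : 4 ≤ N ^ 2 := by nlinarith
    calc 4 * (N + 1) ^ 4 ≤ N ^ 2 * (N ^ 2) ^ 4 := Nat.mul_le_mul h3 h2
      _ = N ^ 10 := by ring
      _ ≤ N ^ 64 := Nat.pow_le_pow_right (by omega) (by norm_num)
      _ ≤ N ^ 64 + 64 := Nat.le_add_right _ _

/-- **Item `StDivisionEasy` (stmt-ValiantsHypothesis-10463): Jerrum–Snir's directed spanning
tree polynomial has polynomial division complexity over `ℝ≥0`.** For every `N` the polynomial
`h = h_N` of `exists_stPoly_mul` (product of substituted pivots of the star–mesh elimination) is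
nonzero and `L(ST_N · h) + L(h) ≤ 4 (N+1)^4 ≤ N^64 + 64`.
[cite: FominGrigorievKoshevoy2014, Thm 7.2] -/
theorem stDivisionEasy_proof :
    Summit.ValiantsHypothesis.ValiantsHypothesis.Theses.DivisionGap.StDivisionEasy := by
  refine ⟨64, fun N => ?_⟩
  obtain ⟨F, h, hF, hpos, hcF, hch⟩ := exists_stPoly_mul N
  have hh : h ≠ 0 := by
    intro h0
    have := hpos (fun _ => 1) (fun _ => one_pos)
    rw [h0, map_zero] at this
    exact lt_irrefl _ this
  refine ⟨h, hh, ?_⟩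
  rw [inline_eq_stPoly, ← hF]
  calc complexity F + complexity h ≤ 2 * (N + 1) ^ 4 + 2 * (N + 1) ^ 4 := Nat.add_le_add hcF hch
    _ = 4 * (N + 1) ^ 4 := by ring
    _ ≤ N ^ 64 + 64 := four_mul_succ_pow_four_le N

end Summit.ValiantsHypothesis.DivisionGap
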